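import Summits.QuantumFields.BalabanUV.Beta.FP.TransportInfinityM

/-!
# `BalabanUV.Beta.FP.StepLawAssembly` — road «FP» for binder row D1, the N2 ASSEMBLY SOCKET: (Fubini∞ identity with remainder, N2a+N1) ∧ ((SDF)∞, N2b) ∧
# (Ward data of the perfect one-step kernel, N3/N4) ∧ (admissible perfect `m`-step transport, N5b-2 + X1m) ⟹ the STEP LAW `fPerf (m+1) = fPerf m + fPerf 1`
# — LITERALLY the binder `hstep` of `FP/PerfectObjectsT.d1Drift_JsBalOf_of_perfect_step_law_bounded / _littleO` — by linearity of `tsum` and an4's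
# `d = 4` marginality `HessianTelescopingKKT.hasSum_transport_m2Tensor` BY NAME

HONEST FRAMING (cell contract, verbatim): «discharging `BetaPertH` makes Bałaban's UV stability UNCONDITIONAL — a real constructive-QFT result;
it is NOT the continuum limit and NOT the Clay problem.»  THIS MODULE DISCHARGES NOTHING: it is plumbing.  Every analytic input — the fixed-point Fubini
identity (leaf N2a, with the lifted `m`-step term identified by N1), the vanishing second moment of the step defect ((SDF)∞, leaf N2b), the Ward data
(T0)/(T1)/AbsMoment₂ of the perfect one-step kernel (leaves N3/N4), the X1m convergence data of the rescaled (j, m)-resolvent families (row G-an2-4 side) —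
is a HYPOTHESIS, displayed in the signature.  Skeleton `HOME/beta/skeletons/D1-b2b-balaban-beta-d1-p3.md` §3 N2 («Route: N2a ∧ N2b ∧ N3 ∧ N4 ∧ N5 ⇒ N2 by
linearity of `secondMoment`»); claim table `HOME/b2b-balaban-beta-d1-p3/LEAVES-FP.md` sub-row N2-asm (unit `b2b-balaban-beta-d1-formalise-leaf-02`).
NOT BetaPertH, NOT continuum, NOT Clay.
ABSOLUTE RULE (cell, verbatim): «No internally-minted statement may enter as a cited fact. Every hypothesis is either kernel-proved in this package or a
verbatim quotation of a PUBLISHED theorem with page reference.»  Nothing is cited; no `def`; no binder instantiated at a value.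

THE SOCKET SHAPES (what the N2a / N2b claimants must deliver, for abstract families `TP w D : ℕ → EKer 4` and blockings `N : ℕ → ℕ`):
* (Fubini∞ with remainder)  `∀ m ≥ 1, ∀ a b z, TP (m+1) a b z = (N m)^8 · dressedEntry (w m) (TP 1) ((N m) • z) a b + TP m a b z + D m a b z`
  — READING: the one-loop polarization of `m+1` perfect steps = the FIRST step's kernel transported through the perfect `m`-step minimiser on both legs
  (blocking `N m = Lc^m`, weights `w m` = the column of `KPerf … m`, `FP/TransportInfinityM.colOf`) + the `m`-step polarization of the once-blocked system
  (= `TP m` by stationarity, leaf N1) + the step defect `D m`;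
* ((SDF)∞)  `∀ m ≥ 1, secondMoment (D m) μ ν = 0`;
* (admissibility)  `∀ m ≥ 1, EntryHyps (N m) (w m) (TP 1)` — supplied for the perfect family by `TransportInfinityM.entryHyps_perfCol` from the X1m binders and
  the Ward data of `TP 1`.
CONTENT: §1 `m2Tensor_succ_of_fubini` (tensor level, remainder kept), `secondMoment_eq_m2Tensor`, `secondMoment_succ_of_fubini` ((1.22) read-out, remainder killed by
(SDF)∞); §2 **`fPerf_succ_of_fubini`** (the END's `hstep` for the
perfect family) and `fPerf_eq_mul_of_fubini` (`fPerf m = m · fPerf 1`, `FP/RoadEnd.pow_law_of_step_law'` BY NAME).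
§3 (v1.1) `hdec_TPerfOf` / `absMoment₂_TPerfOf` (uniform (5.10) decay of `TPerfOf n K S W` from CLASS data `Decays K`, `LocStencil S`, `VertexFamily₂ W n`),
`wardData_of_printed_flip` ((T0)/(T1) from the printed laws of `flipK P` + decay), **`fPerf_succ_of_fubini_flip`** (the step law with hT/hT0/hT1/hA discharged from
class data of the perfect triples + `WardTransversal`/`AxisReflectionCovariant` of `flipK (TPerf 1)` — the currency `FP/SymmetryLimit` delivers).
-/

namespace Summit.QuantumFields.BalabanUV.Beta.FP.StepLawAssembly

open Filter Topology
open Literature.MathematicalPhysics.QuantumFieldTheory.Balaban1983to89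
open Literature.MathematicalPhysics.QuantumFieldTheory.Balaban1983to89.Beta
open B12Beta (secondMoment)
open DecimatedMomentSummable (AbsMoment₂ IsMoment₂ summable_smul_of_absMoment₂)
open DressedMomentNormalisation (EKer m2Tensor dressedEntry EntryHyps)
open ExpKernelCalculus (MKer Decays)
open OneStepResolventKernel (Fib)
open HessianTelescopingKKT (hasSum_transport_m2Tensor)
open ScalewiseVectorSeam (readout122 readout122_m2Tensor)
open Summit.QuantumFields.BalabanUV.Beta.FP.RoadEnd (pow_law_of_step_law')
open Summit.QuantumFields.BalabanUV.Beta.HessKerDressedUnits (unitK)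
open Summit.QuantumFields.BalabanUV.Beta.FP.PerfectObjects (KTot)
open Summit.QuantumFields.BalabanUV.Beta.FP.PerfectObjectsT (KPerf SPerfOf WPerfOf TPerfOf fPerf fPerf_def)
open Summit.QuantumFields.BalabanUV.Beta.FP.TransportInfinityM (colOf entryHyps_perfCol)

/-! ## §1 The abstract socket: one more step at tensor level, then at the (1.22) read-out -/

section Abstract

variable {TP w D : ℕ → EKer 4} {N : ℕ → ℕ}

/-- [our object] **ONE MORE PERFECT STEP AT TENSOR LEVEL (remainder kept).**  From the fixed-point Fubini identity with remainder, admissibility of the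
`m`-step transport against `TP 1`, and absolutely summable second moments of `TP m`, `D m`:
`m2Tensor (TP (m+1)) = m2Tensor (TP 1) + m2Tensor (TP m) + m2Tensor (D m)` for every `m ≥ 1` (`hasSum_transport_m2Tensor` BY NAME + `tsum_add`). -/
theorem m2Tensor_succ_of_fubini
    (hfub : ∀ m : ℕ, 1 ≤ m → ∀ (a b : Fin 4) (z : Fin 4 → ℤ),
      TP (m + 1) a b z = ((N m : ℕ) : ℝ) ^ 8 * dressedEntry (w m) (TP 1) (((N m : ℕ) : ℤ) • z) a b + TP m a b z + D m a b z)
    (hadm : ∀ m : ℕ, 1 ≤ m → EntryHyps (N m) (w m) (TP 1))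
    (hA : ∀ m : ℕ, 1 ≤ m → ∀ a b : Fin 4, AbsMoment₂ (TP m a b)) (hDA : ∀ m : ℕ, 1 ≤ m → ∀ a b : Fin 4, AbsMoment₂ (D m a b)) :
    ∀ m : ℕ, 1 ≤ m → m2Tensor (TP (m + 1)) = m2Tensor (TP 1) + m2Tensor (TP m) + m2Tensor (D m) := by
  intro m hm
  funext κ lam a b
  have h1 := hasSum_transport_m2Tensor (hadm m hm) κ lam a b
  have h2 : Summable (fun t : Fin 4 → ℤ => (t κ * t lam) • TP m a b t) :=
    summable_smul_of_absMoment₂ (hA m hm a b) (IsMoment₂.coord2 κ lam)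
  have h3 : Summable (fun t : Fin 4 → ℤ => (t κ * t lam) • D m a b t) :=
    summable_smul_of_absMoment₂ (hDA m hm a b) (IsMoment₂.coord2 κ lam)
  show m2Tensor (TP (m + 1)) κ lam a b = m2Tensor (TP 1) κ lam a b + m2Tensor (TP m) κ lam a b + m2Tensor (D m) κ lam a b
  calc m2Tensor (TP (m + 1)) κ lam a b
      = ∑' t : Fin 4 → ℤ, (((t κ * t lam) • (((N m : ℕ) : ℝ) ^ 8 * dressedEntry (w m) (TP 1) (((N m : ℕ) : ℤ) • t) a b)
          + (t κ * t lam) • TP m a b t) + (t κ * t lam) • D m a b t) := by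
        simp only [m2Tensor]
        exact tsum_congr fun t => by rw [hfub m hm a b t, smul_add, smul_add]
    _ = m2Tensor (TP 1) κ lam a b + m2Tensor (TP m) κ lam a b + m2Tensor (D m) κ lam a b := by
        rw [Summable.tsum_add (h1.summable.add h2) h3, Summable.tsum_add h1.summable h2, h1.tsum_eq]
        rfl

/-- [our object] The printed (1.22) second moment is the diagonal-pair entry of the second-moment tensor (`readout122_m2Tensor` BY NAME). -/
theorem secondMoment_eq_m2Tensor (T : EKer 4) (μ ν : Fin 4) : secondMoment T μ ν = m2Tensor T μ ν μ ν :=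
  (readout122_m2Tensor μ ν T).symm

/-- [our object] **ONE MORE PERFECT STEP AT THE (1.22) READ-OUT, remainder killed by (SDF)∞**:
`secondMoment (TP (m+1)) μ ν = secondMoment (TP m) μ ν + secondMoment (TP 1) μ ν` for every `m ≥ 1`. -/
theorem secondMoment_succ_of_fubini
    (hfub : ∀ m : ℕ, 1 ≤ m → ∀ (a b : Fin 4) (z : Fin 4 → ℤ),
      TP (m + 1) a b z = ((N m : ℕ) : ℝ) ^ 8 * dressedEntry (w m) (TP 1) (((N m : ℕ) : ℤ) • z) a b + TP m a b z + D m a b z)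
    (hadm : ∀ m : ℕ, 1 ≤ m → EntryHyps (N m) (w m) (TP 1))
    (hA : ∀ m : ℕ, 1 ≤ m → ∀ a b : Fin 4, AbsMoment₂ (TP m a b)) (hDA : ∀ m : ℕ, 1 ≤ m → ∀ a b : Fin 4, AbsMoment₂ (D m a b))
    (μ ν : Fin 4) (hSDF : ∀ m : ℕ, 1 ≤ m → secondMoment (D m) μ ν = 0) :
    ∀ m : ℕ, 1 ≤ m → secondMoment (TP (m + 1)) μ ν = secondMoment (TP m) μ ν + secondMoment (TP 1) μ ν := by
  intro m hm
  have h := congrFun (congrFun (congrFun (congrFun (m2Tensor_succ_of_fubini hfub hadm hA hDA m hm) μ) ν) μ) ν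
  simp only [Pi.add_apply] at h
  rw [secondMoment_eq_m2Tensor, secondMoment_eq_m2Tensor, secondMoment_eq_m2Tensor, h, ← secondMoment_eq_m2Tensor (D m), hSDF m hm,
    add_zero, add_comm]

end Abstract

/-! ## §2 The socket at the perfect family: the END's `hstep` -/

section Perfect

variable {Lc : ℕ} [NeZero Lc] {sf sm : ℕ → ℝ} (hunit : ∀ j, sf j * sm j = (Lc : ℝ) ^ (5 * j))
  (S : ℕ → ℕ → Fin (3 + 1) → (Fin (3 + 1) → ℤ) → MKer (3 + 1) (Fib 3))
  (Wt : ℕ → ℕ → Fin (3 + 1) → (Fin (3 + 1) → ℤ) → Fin (3 + 1) → (Fin (3 + 1) → ℤ) → MKer (3 + 1) (Fib 3))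
  {D : ℕ → EKer 4} {C δK c δ θ : ℕ → ℝ}
include hunit

/-- [our object] **THE STEP LAW OF THE PERFECT COEFFICIENT FAMILY FROM THE N2 INPUTS.**  Write `TP m := TPerfOf (Lc^m) (KPerf Lc sf sm m) (SPerfOf sf sm S m)
(WPerfOf sf sm Wt m)` (so `fPerf … m = secondMoment (TP m) μ ν` by `fPerf_def`).  HYPOTHESES, all displayed: bond units `sf j·sm j = Lc^{5j}`; for every `m ≥ 1`
the X1m data of the rescaled (j, m)-resolvents (`j`-uniform `Decays` bound `hK`, all-scales deviations `hKall`, `θ m < 1`); Ward data (T0)/(T1)/AbsMoment₂ of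
the perfect ONE-step kernel `TP 1` (leaves N3/N4); AbsMoment₂ of `TP m` and of the step defect `D m`; the FIXED-POINT FUBINI IDENTITY with remainder `D`
(leaf N2a + N1); (SDF)∞ (leaf N2b).  CONCLUSION: `∀ m ≥ 1, fPerf … (m+1) = fPerf … m + fPerf … 1` — LITERALLY the binder `hstep` of
`FP/PerfectObjectsT.d1Drift_JsBalOf_of_perfect_step_law_bounded / _littleO`.  Discharges nothing by itself. -/
theorem fPerf_succ_of_fubini
    (hC : ∀ m, 0 ≤ C m) (hδK : ∀ m, 0 < δK m)
    (hK : ∀ m j, Decays (unitK (sf j) (sm j) (KTot (d := 3) (Lc ^ (j + m)) (Lc ^ j))) (C m) (δK m))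
    (hKall : ∀ m k j, Decays (unitK (sf (k + j)) (sm (k + j)) (KTot (d := 3) (Lc ^ (k + j + m)) (Lc ^ (k + j)))
      - unitK (sf k) (sm k) (KTot (d := 3) (Lc ^ (k + m)) (Lc ^ k))) (c m * θ m ^ k) (δ m)) (hθ1 : ∀ m, θ m < 1)
    (hT : ∀ a b, AbsMoment₂ (TPerfOf Lc (KPerf Lc sf sm 1) (SPerfOf sf sm S 1) (WPerfOf sf sm Wt 1) a b))
    (hT0 : ∀ a b, HasSum (TPerfOf Lc (KPerf Lc sf sm 1) (SPerfOf sf sm S 1) (WPerfOf sf sm Wt 1) a b) 0)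
    (hT1 : ∀ a b (μ' : Fin 4), HasSum (fun t => t μ' • TPerfOf Lc (KPerf Lc sf sm 1) (SPerfOf sf sm S 1) (WPerfOf sf sm Wt 1) a b t) 0)
    (hA : ∀ m : ℕ, 1 ≤ m → ∀ a b, AbsMoment₂ (TPerfOf (Lc ^ m) (KPerf Lc sf sm m) (SPerfOf sf sm S m) (WPerfOf sf sm Wt m) a b))
    (hDA : ∀ m : ℕ, 1 ≤ m → ∀ a b, AbsMoment₂ (D m a b))
    (hfub : ∀ m : ℕ, 1 ≤ m → ∀ (a b : Fin 4) (z : Fin 4 → ℤ),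
      TPerfOf (Lc ^ (m + 1)) (KPerf Lc sf sm (m + 1)) (SPerfOf sf sm S (m + 1)) (WPerfOf sf sm Wt (m + 1)) a b z
        = ((Lc ^ m : ℕ) : ℝ) ^ 8 * dressedEntry (colOf (KPerf (d := 3) Lc sf sm m))
            (TPerfOf Lc (KPerf Lc sf sm 1) (SPerfOf sf sm S 1) (WPerfOf sf sm Wt 1)) (((Lc ^ m : ℕ) : ℤ) • z) a b
          + TPerfOf (Lc ^ m) (KPerf Lc sf sm m) (SPerfOf sf sm S m) (WPerfOf sf sm Wt m) a b z + D m a b z)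
    (μ ν : Fin 4) (hSDF : ∀ m : ℕ, 1 ≤ m → secondMoment (D m) μ ν = 0) :
    ∀ m : ℕ, 1 ≤ m → fPerf Lc sf sm S Wt μ ν (m + 1) = fPerf Lc sf sm S Wt μ ν m + fPerf Lc sf sm S Wt μ ν 1 := by
  -- the perfect family as an `ℕ → EKer 4`
  set TP : ℕ → EKer 4 := fun m => TPerfOf (Lc ^ m) (KPerf Lc sf sm m) (SPerfOf sf sm S m) (WPerfOf sf sm Wt m) with hTP
  have hTP1 : TP 1 = TPerfOf Lc (KPerf Lc sf sm 1) (SPerfOf sf sm S 1) (WPerfOf sf sm Wt 1) := by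
    simp only [hTP, pow_one]
  have hadm : ∀ m : ℕ, 1 ≤ m → EntryHyps (Lc ^ m) (colOf (KPerf (d := 3) Lc sf sm m)) (TP 1) := fun m _ => by
    rw [hTP1]
    exact entryHyps_perfCol hunit m (hC m) (hδK m) (hK m) (hKall m) (hθ1 m) hT hT0 hT1
  have hfub' : ∀ m : ℕ, 1 ≤ m → ∀ (a b : Fin 4) (z : Fin 4 → ℤ),
      TP (m + 1) a b z = ((Lc ^ m : ℕ) : ℝ) ^ 8 * dressedEntry (colOf (KPerf (d := 3) Lc sf sm m)) (TP 1) (((Lc ^ m : ℕ) : ℤ) • z) a b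
        + TP m a b z + D m a b z := fun m hm a b z => by
    rw [hTP1]; exact hfub m hm a b z
  have h := secondMoment_succ_of_fubini (TP := TP) (w := fun m => colOf (KPerf (d := 3) Lc sf sm m)) (N := fun m => Lc ^ m)
    hfub' hadm (fun m hm => hA m hm) hDA μ ν hSDF
  intro m hm
  have hm' := h m hm
  rw [hTP1] at hm'
  simpa only [fPerf_def, TPerfOf, hTP, pow_one] using hm'

/-- [our object] **THE POWER LAW OF THE PERFECT COEFFICIENT FAMILY** under the same hypotheses: `fPerf … m = m · fPerf … 1` for every `m ≥ 1`. -/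
theorem fPerf_eq_mul_of_fubini
    (hC : ∀ m, 0 ≤ C m) (hδK : ∀ m, 0 < δK m)
    (hK : ∀ m j, Decays (unitK (sf j) (sm j) (KTot (d := 3) (Lc ^ (j + m)) (Lc ^ j))) (C m) (δK m))
    (hKall : ∀ m k j, Decays (unitK (sf (k + j)) (sm (k + j)) (KTot (d := 3) (Lc ^ (k + j + m)) (Lc ^ (k + j)))
      - unitK (sf k) (sm k) (KTot (d := 3) (Lc ^ (k + m)) (Lc ^ k))) (c m * θ m ^ k) (δ m)) (hθ1 : ∀ m, θ m < 1)
    (hT : ∀ a b, AbsMoment₂ (TPerfOf Lc (KPerf Lc sf sm 1) (SPerfOf sf sm S 1) (WPerfOf sf sm Wt 1) a b))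
    (hT0 : ∀ a b, HasSum (TPerfOf Lc (KPerf Lc sf sm 1) (SPerfOf sf sm S 1) (WPerfOf sf sm Wt 1) a b) 0)
    (hT1 : ∀ a b (μ' : Fin 4), HasSum (fun t => t μ' • TPerfOf Lc (KPerf Lc sf sm 1) (SPerfOf sf sm S 1) (WPerfOf sf sm Wt 1) a b t) 0)
    (hA : ∀ m : ℕ, 1 ≤ m → ∀ a b, AbsMoment₂ (TPerfOf (Lc ^ m) (KPerf Lc sf sm m) (SPerfOf sf sm S m) (WPerfOf sf sm Wt m) a b))
    (hDA : ∀ m : ℕ, 1 ≤ m → ∀ a b, AbsMoment₂ (D m a b))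
    (hfub : ∀ m : ℕ, 1 ≤ m → ∀ (a b : Fin 4) (z : Fin 4 → ℤ),
      TPerfOf (Lc ^ (m + 1)) (KPerf Lc sf sm (m + 1)) (SPerfOf sf sm S (m + 1)) (WPerfOf sf sm Wt (m + 1)) a b z
        = ((Lc ^ m : ℕ) : ℝ) ^ 8 * dressedEntry (colOf (KPerf (d := 3) Lc sf sm m))
            (TPerfOf Lc (KPerf Lc sf sm 1) (SPerfOf sf sm S 1) (WPerfOf sf sm Wt 1)) (((Lc ^ m : ℕ) : ℤ) • z) a b
          + TPerfOf (Lc ^ m) (KPerf Lc sf sm m) (SPerfOf sf sm S m) (WPerfOf sf sm Wt m) a b z + D m a b z)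
    (μ ν : Fin 4) (hSDF : ∀ m : ℕ, 1 ≤ m → secondMoment (D m) μ ν = 0) :
    ∀ m : ℕ, 1 ≤ m → fPerf Lc sf sm S Wt μ ν m = (m : ℝ) * fPerf Lc sf sm S Wt μ ν 1 :=
  pow_law_of_step_law' (fPerf_succ_of_fubini hunit S Wt hC hδK hK hKall hθ1 hT hT0 hT1 hA hDA hfub μ ν hSDF)

end Perfect

/-! ## §3 (v1.1) Discharging the generic binders of §2: (5.10)-decay and AbsMoment₂ of `TPerfOf` from CLASS data of the triple, (T0)/(T1) from the
printed laws of the FLIPPED one-step kernel (the form `FP/SymmetryLimit` delivers), and the step law in that currency -/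

section Classes

open PolarizationSign (WardTransversal AxisReflectionCovariant MomentSummable)
open OneStepKernelFamily (flipK)
open OneStepResolventKernel (LocStencil decays_mono biLoc_mono)
open ExpKernelCalculus (VertexFamily VertexFamily₂ hdec_hessKer)
open AxialDressing (axDressK axVertexOfK decays_axDressK vertexFamily_axVertexOfK')
open B12Sec2to5 (Decay510)
open DecimatedMomentSummable (absMoment₂_of_decay510)
open ScalewiseVectorSeam (hasSum_zero_of_ward_flip hasSum_firstMoment_zero_of_reflection_flip absMoment₂_and_momentSummable_of_decay
  decay510_flip)

/-- [our object] **UNIFORM (5.10)-TYPE DECAY OF THE ONE-STEP POLARIZATION KERNEL `TPerfOf n K S W` FROM CLASS DATA**: `Decays K` (rate `> 0`),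
`LocStencil S` (rate `> 0`) and `VertexFamily₂ W n` (rate `> 0`) give one constant and one rate for all sixteen channels — an2's
`decays_axDressK` + `vertexFamily_axVertexOfK'` + the kernel calculus `ExpKernelCalculus.hdec_hessKer`, BY NAME.  (At the perfect triples these
class data are the limit-currency (CONV-C) binders `hKinf`/`hSinf`/`hWinf` of the road's END.) -/
theorem hdec_TPerfOf {n : ℕ} [NeZero n] {K : MKer (3 + 1) (Fib 3)} {C δK : ℝ} (hK : Decays K C δK) (hδK : 0 < δK)
    {S : Fin (3 + 1) → (Fin (3 + 1) → ℤ) → MKer (3 + 1) (Fib 3)} {Cs δS : ℝ} (hS : LocStencil S Cs δS) (hδS : 0 < δS)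
    {W : Fin (3 + 1) → (Fin (3 + 1) → ℤ) → Fin (3 + 1) → (Fin (3 + 1) → ℤ) → MKer (3 + 1) (Fib 3)} {Cw δW : ℝ}
    (hW : VertexFamily₂ W n Cw δW) (hδW : 0 < δW) :
    ∃ C' δ' : ℝ, 0 < δ' ∧ ∀ μ ν : Fin 4, Decay510 (TPerfOf n K S W μ ν) C' δ' := by
  have hn : 1 ≤ n := Nat.one_le_iff_ne_zero.2 (NeZero.ne n)
  have hC : 0 ≤ C := hK.nonneg (Sum.inl 0)
  have hA := decays_axDressK hn hK hδK.le
  obtain ⟨Cv, δv, hδv, hV⟩ := vertexFamily_axVertexOfK' (N := n) ⟨δK, C, hδK, hC, hK⟩ hS hδS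
  have hδ : 0 < min δK (min δv δW) := lt_min hδK (lt_min hδv hδW)
  have hA' := decays_mono hA (hA.nonneg (Sum.inl 0)) le_rfl (min_le_left δK (min δv δW))
  have hCv : 0 ≤ Cv := (hV 0 0).nonneg (Sum.inl 0)
  have hCw : 0 ≤ Cw := (hW 0 0 0 0).nonneg (Sum.inl 0)
  have hV' : VertexFamily (axVertexOfK K n S) n Cv (min δK (min δv δW)) := fun μ y =>
    biLoc_mono (hV μ y) hCv ((min_le_right _ _).trans (min_le_left _ _))
  have hW' : VertexFamily₂ W n Cw (min δK (min δv δW)) := fun μ y ν y' =>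
    biLoc_mono (hW μ y ν y') hCw ((min_le_right _ _).trans (min_le_right _ _))
  exact hdec_hessKer hA' hV' hW' hδ hn

/-- [our object] `AbsMoment₂` of every channel of `TPerfOf n K S W` from the same class data. -/
theorem absMoment₂_TPerfOf {n : ℕ} [NeZero n] {K : MKer (3 + 1) (Fib 3)} {C δK : ℝ} (hK : Decays K C δK) (hδK : 0 < δK)
    {S : Fin (3 + 1) → (Fin (3 + 1) → ℤ) → MKer (3 + 1) (Fib 3)} {Cs δS : ℝ} (hS : LocStencil S Cs δS) (hδS : 0 < δS)
    {W : Fin (3 + 1) → (Fin (3 + 1) → ℤ) → Fin (3 + 1) → (Fin (3 + 1) → ℤ) → MKer (3 + 1) (Fib 3)} {Cw δW : ℝ}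
    (hW : VertexFamily₂ W n Cw δW) (hδW : 0 < δW) (a b : Fin 4) : AbsMoment₂ (TPerfOf n K S W a b) := by
  obtain ⟨C', δ', hδ', h⟩ := hdec_TPerfOf hK hδK hS hδS hW hδW
  exact absMoment₂_of_decay510 hδ' (h a b)

/-- [our object] **(T0)/(T1) OF A KERNEL FROM THE PRINTED LAWS OF ITS FLIP**: a uniform (5.10) decay, Ward transversality (5.9) and axis-reflection
covariance (5.7) of `flipK P` (the kernel's convention, RULING (R21)) give `HasSum (P c e) 0` and `HasSum (t ↦ t_ρ • P c e t) 0`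
(`ScalewiseVectorSeam.hasSum_zero_of_ward_flip` / `hasSum_firstMoment_zero_of_reflection_flip` BY NAME). -/
theorem wardData_of_printed_flip {P : EKer 4} (hdec : ∃ C δ : ℝ, 0 < δ ∧ ∀ μ ν : Fin 4, Decay510 (P μ ν) C δ)
    (hWf : WardTransversal (flipK P)) (hRf : AxisReflectionCovariant (flipK P)) :
    (∀ c e, HasSum (P c e) 0) ∧ (∀ c e (ρ : Fin 4), HasSum (fun t : Fin 4 → ℤ => t ρ • P c e t) 0) := by
  obtain ⟨C, δ, hδ, hd⟩ := hdec
  have hSf : MomentSummable (fun μ ν z => P μ ν (-z)) 3 :=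
    (absMoment₂_and_momentSummable_of_decay (P := fun μ ν z => P μ ν (-z)) hδ (fun μ ν => decay510_flip (hd μ ν))).2
  exact ⟨fun c e => hasSum_zero_of_ward_flip hSf hWf c e, fun c e ρ => hasSum_firstMoment_zero_of_reflection_flip hSf hRf c e ρ⟩

variable {Lc : ℕ} [NeZero Lc] {sf sm : ℕ → ℝ} (hunit : ∀ j, sf j * sm j = (Lc : ℝ) ^ (5 * j))
  (S : ℕ → ℕ → Fin (3 + 1) → (Fin (3 + 1) → ℤ) → MKer (3 + 1) (Fib 3))
  (Wt : ℕ → ℕ → Fin (3 + 1) → (Fin (3 + 1) → ℤ) → Fin (3 + 1) → (Fin (3 + 1) → ℤ) → MKer (3 + 1) (Fib 3))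
  {D : ℕ → EKer 4} {C δK c δ θ CK δK' Cs δS Cw δW : ℕ → ℝ}
include hunit

/-- [our object] **THE STEP LAW IN CLASS CURRENCY.**  As `fPerf_succ_of_fubini`, with the generic binders hT/hT0/hT1/hA DISCHARGED from: the CLASS data of the
perfect triples at every `m ≥ 1` (`Decays (KPerf … m)`, `LocStencil (SPerfOf … m)`, `VertexFamily₂ (WPerfOf … m) (Lc^m)`, positive rates — the limit-currency
(CONV-C) shapes), and the PRINTED LAWS OF THE FLIPPED PERFECT ONE-STEP KERNEL `WardTransversal (flipK (TPerf 1))`, `AxisReflectionCovariant (flipK (TPerf 1))`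
(leaf N3; e.g. `FP/SymmetryLimit.wardTransversal_flipK_of_tendsto` / `axisReflectionCovariant_flipK_of_tendsto`).  Remaining analytic binders: X1m (`hK`, `hKall`,
`hθ1`), the Fubini∞ identity `hfub` (N2a+N1), AbsMoment₂ of the defect and (SDF)∞ `hSDF` (N2b).  Conclusion = the END's `hstep`. -/
theorem fPerf_succ_of_fubini_flip
    (hC : ∀ m, 0 ≤ C m) (hδK : ∀ m, 0 < δK m)
    (hK : ∀ m j, Decays (unitK (sf j) (sm j) (KTot (d := 3) (Lc ^ (j + m)) (Lc ^ j))) (C m) (δK m))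
    (hKall : ∀ m k j, Decays (unitK (sf (k + j)) (sm (k + j)) (KTot (d := 3) (Lc ^ (k + j + m)) (Lc ^ (k + j)))
      - unitK (sf k) (sm k) (KTot (d := 3) (Lc ^ (k + m)) (Lc ^ k))) (c m * θ m ^ k) (δ m)) (hθ1 : ∀ m, θ m < 1)
    (hKinf : ∀ m : ℕ, 1 ≤ m → Decays (KPerf (d := 3) Lc sf sm m) (CK m) (δK' m)) (hδK' : ∀ m, 0 < δK' m)
    (hSinf : ∀ m : ℕ, 1 ≤ m → LocStencil (SPerfOf sf sm S m) (Cs m) (δS m)) (hδS : ∀ m, 0 < δS m)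
    (hWinf : ∀ m : ℕ, 1 ≤ m → VertexFamily₂ (WPerfOf sf sm Wt m) (Lc ^ m) (Cw m) (δW m)) (hδW : ∀ m, 0 < δW m)
    (hWf : WardTransversal (flipK (TPerfOf Lc (KPerf Lc sf sm 1) (SPerfOf sf sm S 1) (WPerfOf sf sm Wt 1))))
    (hRf : AxisReflectionCovariant (flipK (TPerfOf Lc (KPerf Lc sf sm 1) (SPerfOf sf sm S 1) (WPerfOf sf sm Wt 1))))
    (hDA : ∀ m : ℕ, 1 ≤ m → ∀ a b, AbsMoment₂ (D m a b))
    (hfub : ∀ m : ℕ, 1 ≤ m → ∀ (a b : Fin 4) (z : Fin 4 → ℤ),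
      TPerfOf (Lc ^ (m + 1)) (KPerf Lc sf sm (m + 1)) (SPerfOf sf sm S (m + 1)) (WPerfOf sf sm Wt (m + 1)) a b z
        = ((Lc ^ m : ℕ) : ℝ) ^ 8 * dressedEntry (colOf (KPerf (d := 3) Lc sf sm m))
            (TPerfOf Lc (KPerf Lc sf sm 1) (SPerfOf sf sm S 1) (WPerfOf sf sm Wt 1)) (((Lc ^ m : ℕ) : ℤ) • z) a b
          + TPerfOf (Lc ^ m) (KPerf Lc sf sm m) (SPerfOf sf sm S m) (WPerfOf sf sm Wt m) a b z + D m a b z)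
    (μ ν : Fin 4) (hSDF : ∀ m : ℕ, 1 ≤ m → secondMoment (D m) μ ν = 0) :
    ∀ m : ℕ, 1 ≤ m → fPerf Lc sf sm S Wt μ ν (m + 1) = fPerf Lc sf sm S Wt μ ν m + fPerf Lc sf sm S Wt μ ν 1 := by
  -- class data at m = 1, blocking `Lc ^ 1 = Lc`
  have hW1 : VertexFamily₂ (WPerfOf sf sm Wt 1) Lc (Cw 1) (δW 1) := by simpa only [pow_one] using hWinf 1 le_rfl
  have hK1 : Decays (KPerf (d := 3) Lc sf sm 1) (CK 1) (δK' 1) := hKinf 1 le_rfl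
  have hdec1 := hdec_TPerfOf (n := Lc) hK1 (hδK' 1) (hSinf 1 le_rfl) (hδS 1) hW1 (hδW 1)
  obtain ⟨hT0, hT1⟩ := wardData_of_printed_flip hdec1 hWf hRf
  have hT : ∀ a b, AbsMoment₂ (TPerfOf Lc (KPerf Lc sf sm 1) (SPerfOf sf sm S 1) (WPerfOf sf sm Wt 1) a b) :=
    absMoment₂_TPerfOf (n := Lc) hK1 (hδK' 1) (hSinf 1 le_rfl) (hδS 1) hW1 (hδW 1)
  have hA : ∀ m : ℕ, 1 ≤ m → ∀ a b,
      AbsMoment₂ (TPerfOf (Lc ^ m) (KPerf Lc sf sm m) (SPerfOf sf sm S m) (WPerfOf sf sm Wt m) a b) := fun m hm =>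
    absMoment₂_TPerfOf (n := Lc ^ m) (hKinf m hm) (hδK' m) (hSinf m hm) (hδS m) (hWinf m hm) (hδW m)
  exact fPerf_succ_of_fubini hunit S Wt hC hδK hK hKall hθ1 hT hT0 hT1 hA hDA hfub μ ν hSDF

end Classes

end Summit.QuantumFields.BalabanUV.Beta.FP.StepLawAssembly
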